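import Literature.MathematicalPhysics.QuantumFieldTheory.Balaban1983to89.B10Decomposition7
import Literature.MathematicalPhysics.QuantumFieldTheory.Balaban1983to89.T4WilsonGaugeFlatDirection
import Literature.MathematicalPhysics.QuantumFieldTheory.Balaban1983to89.MissingProofs

/-!
# `Summit.QuantumFields.Balaban3D.Proofs.Decomposition8` — [Balaban1985UV3] **(7)–(8)** pp. 257–258 (the decomposition of unity in
# large-field / small-field characteristic functions and its partial resummation over the domains Ω₁) ON THE LANE'S LATTICE: for the
# tree's torus `Setup.Plaq P j`, plaquette variables `U(∂p) = GaugeField.plaqHol U p` and deviations `|U(∂p) − 1| = dist1 (U(∂p))`,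
# the (8)-weights `ζ_{Ω₁ᶜ}χ_{Ω₁}` of ANY assignment rule form a MEASURABLE, GAUGE-INVARIANT PARTITION OF UNITY with values in
# [0, 1], indexed by the admissible domains — lane `pub-balaban3d`, seat p4 (PLAN.md §3.4 «p4 ← (7)–(22)»)

HONEST FRAMING (lane PLAN.md §0, binding): see `…Proofs.SectAFirstStep`.  (7)–(8) are finite identities between characteristic
functions; nothing else of [Balaban1985UV3] is touched.

WHAT IS PRINTED.  p. 257 = PDF 3 L28–35 and p. 258 = PDF 4 L1–7 (renders `…-p003-x2.png`, `…-p004-x2.png`), verbatim: «We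
introduce the decomposition of unity  1 = Σ_P Π_{p∈P} χ({|U(∂p) − 1| ≥ ε₁}) Π_{p∈Pᶜ} χ({|U(∂p) − 1| < ε₁}),  (7)  where the sum is
over sets P of plaquettes of the lattice T. … to each term of the decomposition we assign a subset Ω₁ ⊂ T₁ defined as a union of
big blocks … such that their distances to P are > RM₁. … Now we perform a partial resummation over all P determining the same
domain Ω₁, and we write the decomposition (7) as  1 = Σ_{admissible Ω₁} ζ_{Ω₁ᶜ} χ_{Ω₁},  (8)  where χ_{Ω₁} involves the
characteristic functions in (7) connected with plaquettes p ∈ Ω₁, i.e. plaquettes with at least one corner belonging to Ω₁. The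
meaning of ζ_{Ω₁ᶜ} is clear.»  p. 258 L8–9: «The underintegral expression in Tρ₀ is invariant with respect to gauge
transformations …» (the weights are gauge invariant: |U^u(∂p) − 1| = |U(∂p) − 1|).

WHAT LQB ALREADY HAS (RE-USED BY NAME): `B10Decomposition7` proves (7) and (8) as EXACT finite identities over any commutative
semiring for abstract plaquette sets and deviation profiles: `chiGe`/`chiLt` (the two characteristic functions), `chiGe_add_chiLt`,
`zetaDom`/`chiDom` (ζ_{Ω₁ᶜ}, χ_{Ω₁}), `admissible` (the image of the rule), `resummation8_eq_one` (any rule with the separation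
`hstar`: no plaquette of P is cornered in Ω₁(P)), `domRule`/`starRule`/`starRule_subset_sdiff`/`resummation8_rule` (the printed
rule: blocks at distance > RM₁ from P).

WHAT THIS FILE PROVES (no `sorry`, axioms standard; NO definitions — the weight is written out as LQB's
`zetaDom univ (chiGe ε₁ (dev U)) (chiLt ε₁ (dev U)) dom star Ω * chiDom (chiLt ε₁ (dev U)) star Ω` with
`dev U p = dist1 (plaqHol U p)`, so that the carrier seat (p1, `Carriers/Histories.lean`) names it as it likes):
* §1 `dist1_plaqHol_gaugeAct`, `dev_gaugeAct` — from LQB `T4WilsonGaugeFlatDirection.plaqHol_gaugeAct` (`U^u(∂p) = u(p₋)U(∂p)u(p₋)⁻¹`):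
  `|U^u(∂p) − 1| = |U(∂p) − 1|`, the deviation profile is gauge invariant;
* §2 for ANY rule `dom : Finset (Plaq P j) → σ` with starred plaquettes `star : σ → Finset (Plaq P j)` satisfying the printed
  separation `star (dom P) ⊆ univ ∖ P`: `sum_weight8_eq_one` (**(8)**: `Σ_{Ω ∈ admissible} ζ_{Ωᶜ}(U)χ_Ω(U) = 1` for every `U`),
  `weight8_nonneg`, `weight8_le_one` (values in [0, 1]), `weight8_gaugeAct` (gauge invariance), and — under measurability of the
  group operations (LQB `Missing.measurable_plaqHol`) and of `dist1` — `measurable_weight8`; i.e. EXACTLY the four hypotheses `hws`, `hwb`, `hwinv`, `hwm` on the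
  weight family of p1's `Carriers/Formula10.formula10_sum` ((10) p. 258 with (8) inserted), for `s := admissible univ dom`;
* §3 `sum_weight8_rule_eq_one` — the same for the PRINTED rule (`domRule`/`starRule` over any finite big-block data with «a block
  containing a corner of p is at distance 0 from p» and `RM₁ ≥ 0`), = LQB `resummation8_rule` on the lane's lattice.
NOT HERE: the choice of big blocks / distances on the torus (p1's histories, R-PIECES (a)); the step-k version on Λ_k (LQB
`B10Decomposition7.resummation48`, same instantiation); anything about T (p1 `Formula10`).
-/

namespace Summit.QuantumFields.Balaban3D.Proofs.Decomposition8

open Literature.MathematicalPhysics.QuantumFieldTheory.Balaban1983to89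
open Literature.MathematicalPhysics.QuantumFieldTheory.Balaban1983to89.B10Decomposition7
  (chiGe chiLt chiGe_add_chiLt zetaDom chiDom admissible resummation8_eq_one domRule starRule starRule_subset_sdiff)
open Finset

variable {P : Params} {j : ℕ} {G : Type*} [GaugeGroup G]

/-! ## §1 The deviation profile `p ↦ |U(∂p) − 1|` is gauge invariant -/

/-- The deviation `|U(∂p) − 1|` of a plaquette variable is gauge invariant (`dist1 (h g h⁻¹) = dist1 g`): p. 258 L8–9 «The
underintegral expression in Tρ₀ is invariant with respect to gauge transformations». [cite: Balaban1985UV3, (7) p.257] -/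
theorem dist1_plaqHol_gaugeAct (u : GaugeTransf P j G) (U : GaugeField P j G) (p : Plaq P j) :
    dist1 (GaugeField.plaqHol (GaugeField.gaugeAct u U) p) = dist1 (GaugeField.plaqHol U p) := by
  rw [T4WilsonGaugeFlatDirection.plaqHol_gaugeAct, GaugeGroup.dist1_conj]

/-- … hence so is the whole deviation profile `p ↦ |U(∂p) − 1|` of (7). [cite: Balaban1985UV3, (7) p.257] -/
theorem dev_gaugeAct (u : GaugeTransf P j G) (U : GaugeField P j G) :
    (fun p : Plaq P j => dist1 (GaugeField.plaqHol (GaugeField.gaugeAct u U) p)) =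
      fun p => dist1 (GaugeField.plaqHol U p) := by
  funext p; exact dist1_plaqHol_gaugeAct u U p

/-- The characteristic functions of (7) are 0/1-valued, so `χ_≥ ≥ 0`. [folklore] -/
theorem chiGe_nonneg (ε₁ : ℝ) (dev : Plaq P j → ℝ) (p : Plaq P j) : 0 ≤ chiGe ε₁ dev p := by
  unfold chiGe; split_ifs <;> norm_num

/-- … and `χ_< ≥ 0`. [folklore] -/
theorem chiLt_nonneg (ε₁ : ℝ) (dev : Plaq P j → ℝ) (p : Plaq P j) : 0 ≤ chiLt ε₁ dev p := by
  unfold chiLt; split_ifs <;> norm_num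

/-! ## §2 The (8)-weights of any assignment rule: a measurable gauge-invariant partition of unity -/

section AnyRule

variable [DecidableEq (Plaq P j)] {σ : Type*} [DecidableEq σ]
  (ε₁ : ℝ) (dom : Finset (Plaq P j) → σ) (star : σ → Finset (Plaq P j))

/-- **(8) p. 258 = PDF 4 L4–7 on the lane's lattice**: for every configuration `U` on `T^{(j)}`, every threshold `ε₁` and every
rule `P ↦ Ω₁(P)` whose starred plaquettes avoid `P` («By this definition p ⊂ Ω₁ᶜ», p. 257 L35; hypothesis `hstar`),
`Σ_{Ω₁ admissible} ζ_{Ω₁ᶜ}(U)·χ_{Ω₁}(U) = 1` with the weights of LQB `B10Decomposition7` evaluated at the deviations `|U(∂p) − 1|`.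
(`resummation8_eq_one` + `chiGe_add_chiLt`.) [cite: Balaban1985UV3, (8) p.258] -/
theorem sum_weight8_eq_one (hstar : ∀ Q : Finset (Plaq P j), Q ⊆ univ → star (dom Q) ⊆ univ \ Q) (U : GaugeField P j G) :
    ∑ Ω ∈ admissible univ dom,
      zetaDom univ (chiGe ε₁ fun p => dist1 (GaugeField.plaqHol U p)) (chiLt ε₁ fun p => dist1 (GaugeField.plaqHol U p))
          dom star Ω *
        chiDom (chiLt ε₁ fun p => dist1 (GaugeField.plaqHol U p)) star Ω = 1 :=
  resummation8_eq_one univ _ _ (fun p _ => chiGe_add_chiLt ε₁ _ p) dom star hstar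

/-- Each (8)-weight `ζ_{Ω₁ᶜ}(U)·χ_{Ω₁}(U)` is `≥ 0` (a sum of products of 0/1 characteristic functions). [cite: Balaban1985UV3, (8) p.258] -/
theorem weight8_nonneg (U : GaugeField P j G) (Ω : σ) :
    0 ≤ zetaDom univ (chiGe ε₁ fun p => dist1 (GaugeField.plaqHol U p)) (chiLt ε₁ fun p => dist1 (GaugeField.plaqHol U p))
          dom star Ω *
        chiDom (chiLt ε₁ fun p => dist1 (GaugeField.plaqHol U p)) star Ω := by
  refine mul_nonneg ?_ ?_
  · unfold zetaDom
    exact sum_nonneg fun Q _ => mul_nonneg (prod_nonneg fun p _ => chiGe_nonneg ε₁ _ p)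
      (prod_nonneg fun p _ => chiLt_nonneg ε₁ _ p)
  · unfold chiDom
    exact prod_nonneg fun p _ => chiLt_nonneg ε₁ _ p

/-- … and `≤ 1` (the weights are nonnegative and sum to 1 over the admissible domains). [cite: Balaban1985UV3, (8) p.258] -/
theorem weight8_le_one (hstar : ∀ Q : Finset (Plaq P j), Q ⊆ univ → star (dom Q) ⊆ univ \ Q) (U : GaugeField P j G)
    {Ω : σ} (hΩ : Ω ∈ admissible univ dom) :
    zetaDom univ (chiGe ε₁ fun p => dist1 (GaugeField.plaqHol U p)) (chiLt ε₁ fun p => dist1 (GaugeField.plaqHol U p))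
          dom star Ω *
        chiDom (chiLt ε₁ fun p => dist1 (GaugeField.plaqHol U p)) star Ω ≤ 1 := by
  rw [← sum_weight8_eq_one ε₁ dom star hstar U]
  exact single_le_sum (fun Ω' _ => weight8_nonneg ε₁ dom star U Ω') hΩ

/-- The (8)-weights are GAUGE INVARIANT (they depend on `U` only through the deviations `|U(∂p) − 1|`, §1): p. 258 L8–9.
[cite: Balaban1985UV3, (8) p.258] -/
theorem weight8_gaugeAct (u : GaugeTransf P j G) (U : GaugeField P j G) (Ω : σ) :
    zetaDom univ (chiGe ε₁ fun p => dist1 (GaugeField.plaqHol (GaugeField.gaugeAct u U) p))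
          (chiLt ε₁ fun p => dist1 (GaugeField.plaqHol (GaugeField.gaugeAct u U) p)) dom star Ω *
        chiDom (chiLt ε₁ fun p => dist1 (GaugeField.plaqHol (GaugeField.gaugeAct u U) p)) star Ω =
      zetaDom univ (chiGe ε₁ fun p => dist1 (GaugeField.plaqHol U p)) (chiLt ε₁ fun p => dist1 (GaugeField.plaqHol U p))
          dom star Ω *
        chiDom (chiLt ε₁ fun p => dist1 (GaugeField.plaqHol U p)) star Ω := by
  rw [dev_gaugeAct u U]

variable [MeasurableSpace G] [MeasurableMul₂ G] [MeasurableInv G]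

omit [DecidableEq (Plaq P j)] [DecidableEq σ] in
/-- With `dist1 : G → ℝ` measurable, `U ↦ χ({|U(∂p) − 1| ≥ ε₁})` is measurable. [folklore] -/
theorem measurable_chiGe (hdist : Measurable (dist1 : G → ℝ)) (p : Plaq P j) :
    Measurable fun U : GaugeField P j G => chiGe ε₁ (fun q => dist1 (GaugeField.plaqHol U q)) p := by
  unfold chiGe
  refine Measurable.ite ?_ measurable_const measurable_const
  exact measurableSet_le measurable_const (hdist.comp (Missing.measurable_plaqHol p))

omit [DecidableEq (Plaq P j)] [DecidableEq σ] in
/-- With `dist1 : G → ℝ` measurable, `U ↦ χ({|U(∂p) − 1| < ε₁})` is measurable. [folklore] -/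
theorem measurable_chiLt (hdist : Measurable (dist1 : G → ℝ)) (p : Plaq P j) :
    Measurable fun U : GaugeField P j G => chiLt ε₁ (fun q => dist1 (GaugeField.plaqHol U q)) p := by
  unfold chiLt
  refine Measurable.ite ?_ measurable_const measurable_const
  exact measurableSet_lt (hdist.comp (Missing.measurable_plaqHol p)) measurable_const

/-- The (8)-weights are MEASURABLE functions of the configuration (finite sums of finite products of measurable characteristic
functions), given measurable group operations and a measurable `dist1` (both automatic for the matrix groups of
`Balaban1985CMP102.Setting.GroupModel`). [cite: Balaban1985UV3, (8) p.258] -/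
theorem measurable_weight8 (hdist : Measurable (dist1 : G → ℝ)) (Ω : σ) :
    Measurable fun U : GaugeField P j G =>
      zetaDom univ (chiGe ε₁ fun p => dist1 (GaugeField.plaqHol U p)) (chiLt ε₁ fun p => dist1 (GaugeField.plaqHol U p))
          dom star Ω *
        chiDom (chiLt ε₁ fun p => dist1 (GaugeField.plaqHol U p)) star Ω := by
  refine Measurable.mul ?_ ?_
  · unfold zetaDom
    refine Finset.measurable_sum _ fun Q _ => ?_
    exact (Finset.measurable_prod _ fun p _ => measurable_chiGe ε₁ hdist p).mul
      (Finset.measurable_prod _ fun p _ => measurable_chiLt ε₁ hdist p)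
  · unfold chiDom
    exact Finset.measurable_prod _ fun p _ => measurable_chiLt ε₁ hdist p

end AnyRule

/-! ## §3 The printed rule: blocks at distance `> RM₁` from the large-field plaquettes -/

section PrintedRule

variable [DecidableEq (Plaq P j)] {β : Type*} [DecidableEq β]

/-- **(8) for the PRINTED assignment** p. 257 L31–35 («a subset Ω₁ ⊂ T₁ defined as a union of big blocks … such that their
distances to P are > RM₁») on the lane's lattice: for any finite set of big blocks `blocks`, block–plaquette distances `bd` with
«a block containing a corner of p is at distance 0 from p» (`hbd`, via `cb p` = the blocks containing a corner of p), `RM₁ ≥ 0`,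
every threshold `ε₁` and every configuration `U`, the weights of LQB's `domRule`/`starRule` sum to 1 over the admissible domains
(= LQB `resummation8_rule` at `dev = |U(∂·) − 1|`); §2 gives their values in [0, 1], gauge invariance and measurability with
`hstar := starRule_subset_sdiff …`. [cite: Balaban1985UV3, (8) p.258] -/
theorem sum_weight8_rule_eq_one (ε₁ : ℝ) (blocks : Finset β) (bd : β → Plaq P j → ℝ) (RM : ℝ) (cb : Plaq P j → Finset β)
    (hbd : ∀ p ∈ (univ : Finset (Plaq P j)), ∀ B ∈ cb p, bd B p = 0) (hRM : 0 ≤ RM) (U : GaugeField P j G) :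
    ∑ Ω ∈ admissible univ (domRule blocks bd RM),
      zetaDom univ (chiGe ε₁ fun p => dist1 (GaugeField.plaqHol U p)) (chiLt ε₁ fun p => dist1 (GaugeField.plaqHol U p))
          (domRule blocks bd RM) (starRule univ cb) Ω *
        chiDom (chiLt ε₁ fun p => dist1 (GaugeField.plaqHol U p)) (starRule univ cb) Ω = 1 :=
  sum_weight8_eq_one ε₁ (domRule blocks bd RM) (starRule univ cb)
    (fun Q _ => starRule_subset_sdiff univ blocks bd RM cb hbd hRM Q) U

end PrintedRule

end Summit.QuantumFields.Balaban3D.Proofs.Decomposition8
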